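import Summits.Ventures.PercRepro.C026BadBridge
import Summits.Ventures.PercRepro.C026GluingDefs

/-!
# THEOREM L2 when every bare vertex has at most two edges (p6, gen 21)

A skeleton whose vertices other than the probe `c` and the live vertices `a, b` carry at most two edges
each is a subdivided multigraph on the three marks (cycles, theta graphs, paths, and their unions).  On
such a skeleton NO `(D,A)` source is Bad (`good_of_bare_degree_le_two`): a shortest red path from `c`
to a live vertex, cut at the first live vertex it meets, passes only through bare vertices whose two
edges are both red — none of them lies in a blue cluster — so it avoids the blue cluster of the other
live vertex.  Hence `n(D,A) ≤ #Good_a + #Good_b ≤ |B|` (`card_DA_le_B_of_bare_degree_le_two`: the count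
behind `(CF)` with room `n(B,C)`) and THEOREM L2 holds at every band state
(`pFun_threeCells_nonneg_of_bare_degree_le_two`).  In particular CONJECTURE (P) with at most two live
vertices holds on every cycle skeleton — mine-3's THEOREM C (MINE3-GLUING §30) at `k ≤ 2`, in the kernel.

Tools: the open subgraph `G.openGraph S` (typer-1) and Mathlib's paths — a `Reachable` pair has a
`Path` (`Reachable.elim_path`), whose support has no repeated vertex (`isPath_def`); an internal vertex
of a path carries two distinct open edges (`exists_two_open_edges_of_mem_support`); a vertex all of whose
edges are open lies in no blue cluster but its own (`not_mem_cluster_compl_of_forall_open`); an open path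
avoiding a vertex set is a `WalkAvoiding` (`walkAvoiding_of_walk`).
-/

namespace PercRepro

namespace MultiGraph

open Finset SimpleGraph

variable {V E : Type*} {G : MultiGraph V E}

section Paths

/-- An edge of the open subgraph is an open edge of `G` between its endpoints. -/
theorem exists_open_edge_of_adj {ω : Config E} {u v : V} (h : (G.openGraph ω).Adj u v) :
    ∃ e, ω e = true ∧ ((G.fst e = u ∧ G.snd e = v) ∨ (G.fst e = v ∧ G.snd e = u)) := by
  rcases (SimpleGraph.fromRel_adj _ _ _).1 h with ⟨_, h' | h'⟩
  · exact h'
  · obtain ⟨e, he, hend⟩ := h'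
    exact ⟨e, he, hend.symm⟩

/-- An open path none of whose vertices lies in `W` is an open walk avoiding `W`. -/
theorem walkAvoiding_of_walk {ω : Config E} {W : Set V} {u x : V} (p : (G.openGraph ω).Walk u x)
    (hW : ∀ v ∈ p.support, v ∉ W) : G.WalkAvoiding ω W u x := by
  induction p with
  | nil => exact ⟨hW _ (Walk.start_mem_support _), Relation.ReflTransGen.refl⟩
  | @cons u v x h q ih =>
    have hq : ∀ w ∈ q.support, w ∉ W := fun w hw => hW w (by simp [Walk.support_cons, hw])
    obtain ⟨hv, hrest⟩ := ih hq
    refine ⟨hW u (Walk.start_mem_support _), Relation.ReflTransGen.head ⟨?_, hv⟩ hrest⟩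
    rcases (SimpleGraph.fromRel_adj _ _ _).1 h with ⟨_, h' | h'⟩
    · exact h'
    · exact h'.symm

/-- An internal vertex of an open path carries two distinct open edges. -/
theorem exists_two_open_edges_of_mem_support {ω : Config E} {u x : V}
    (p : (G.openGraph ω).Walk u x) (hp : p.IsPath) {v : V} (hv : v ∈ p.support) (hvu : v ≠ u)
    (hvx : v ≠ x) :
    ∃ e e' : E, e ≠ e' ∧ ω e = true ∧ ω e' = true ∧ G.EdgeAt e v ∧ G.EdgeAt e' v := by
  induction p with
  | nil =>
    rw [Walk.support_nil, List.mem_singleton] at hv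
    exact absurd hv hvu
  | @cons u w x h q ih =>
    rw [Walk.support_cons, List.mem_cons] at hv
    rcases hv with rfl | hv
    · exact absurd rfl hvu
    · rw [Walk.cons_isPath_iff] at hp
      by_cases hvw : v = w
      · subst hvw
        cases q with
        | nil => exact absurd rfl hvx
        | @cons _ w' _ h' q' =>
          obtain ⟨e, he, hend⟩ := exists_open_edge_of_adj h
          obtain ⟨e', he', hend'⟩ := exists_open_edge_of_adj h'
          have huv : u ≠ v := ((SimpleGraph.fromRel_adj _ _ _).1 h).1
          have hvw' : v ≠ w' := ((SimpleGraph.fromRel_adj _ _ _).1 h').1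
          have huw' : u ≠ w' := by
            rintro rfl
            exact hp.2 (by simp [Walk.support_cons])
          refine ⟨e, e', ?_, he, he', ?_, ?_⟩
          · rintro rfl
            rcases hend with ⟨h1, h2⟩ | ⟨h1, h2⟩ <;> rcases hend' with ⟨h3, h4⟩ | ⟨h3, h4⟩
            · exact huv (h1.symm.trans h3)
            · exact huw' (h1.symm.trans h3)
            · exact huw' (h2.symm.trans h4)
            · exact hvw' (h1.symm.trans h3)
          · rcases hend with ⟨_, h2⟩ | ⟨h1, _⟩
            · exact Or.inr h2
            · exact Or.inl h1
          · rcases hend' with ⟨h3, _⟩ | ⟨_, h4⟩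
            · exact Or.inl h3
            · exact Or.inr h4
      · exact ih hp.1 hv hvw hvx

/-- A vertex all of whose edges are open lies in no blue cluster other than its own. -/
theorem not_mem_cluster_compl_of_forall_open {ω : Config E} {y v : V} (hvy : v ≠ y)
    (hall : ∀ e, G.EdgeAt e v → ω e = true) : v ∉ G.cluster ωᶜ y := by
  intro hv
  rw [mem_cluster] at hv
  rcases Relation.ReflTransGen.cases_tail hv with h | ⟨z, _, hzv⟩
  · exact hvy h
  · obtain ⟨e, he, hend⟩ := hzv
    have hopen : ω e = true := hall e (by
      rcases hend with ⟨_, h2⟩ | ⟨h1, _⟩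
      · exact Or.inr h2
      · exact Or.inl h1)
    simp [Pi.compl_apply, hopen] at he

end Paths

section BareDegreeTwo

variable {a b c : V}

/-- Along a path from the probe to one live vertex `x` that misses the other live vertex `y`, no
vertex lies in the blue cluster of `y`: the probe and `x` by the blue type `A`, the internal vertices
because their two edges are red. -/
theorem path_avoids_cluster
    (hdeg : ∀ v, v ≠ a → v ≠ b → v ≠ c → ∀ e f g : E, G.EdgeAt e v → G.EdgeAt f v →
      G.EdgeAt g v → e = f ∨ e = g ∨ f = g)
    {S : Config E} (hA : ¬ G.Conn Sᶜ c a ∧ ¬ G.Conn Sᶜ c b ∧ ¬ G.Conn Sᶜ a b) {x y : V}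
    (hxy : (x = a ∧ y = b) ∨ (x = b ∧ y = a)) (q : (G.openGraph S).Walk c x) (hq : q.IsPath)
    (hy : y ∉ q.support) : ∀ v ∈ q.support, v ∉ G.cluster Sᶜ y := by
  intro v hv
  rw [mem_cluster]
  by_cases hvc : v = c
  · subst hvc
    intro h
    rcases hxy with ⟨_, rfl⟩ | ⟨_, rfl⟩
    · exact hA.2.1 h.symm
    · exact hA.1 h.symm
  by_cases hvx : v = x
  · subst hvx
    intro h
    rcases hxy with ⟨rfl, rfl⟩ | ⟨rfl, rfl⟩
    · exact hA.2.2 h.symm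
    · exact hA.2.2 h
  -- an internal vertex: it is bare, so its two open edges are all its edges
  have hvy : v ≠ y := fun h => hy (h ▸ hv)
  obtain ⟨e, e', hee', he, he', hev, he'v⟩ :=
    exists_two_open_edges_of_mem_support q hq hv hvc hvx
  have hva : v ≠ a := by
    rcases hxy with ⟨rfl, _⟩ | ⟨_, rfl⟩
    · exact hvx
    · exact hvy
  have hvb : v ≠ b := by
    rcases hxy with ⟨_, rfl⟩ | ⟨rfl, _⟩
    · exact hvy
    · exact hvx
  have hall : ∀ g, G.EdgeAt g v → S g = true := by
    intro g hg
    rcases hdeg v hva hvb hvc e e' g hev he'v hg with h | h | h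
    · exact absurd h hee'
    · exact h ▸ he
    · exact h ▸ he'
  exact fun h => not_mem_cluster_compl_of_forall_open hvy hall ((G.mem_cluster).2 h)

/-- **No Bad source when every bare vertex has at most two edges**: every `(D,A)` source is `Good_a`
or `Good_b`. -/
theorem good_of_bare_degree_le_two [DecidableEq V]
    (hdeg : ∀ v, v ≠ a → v ≠ b → v ≠ c → ∀ e f g : E, G.EdgeAt e v → G.EdgeAt f v →
      G.EdgeAt g v → e = f ∨ e = g ∨ f = g)
    {S : Config E} (hca : G.Conn S c a)
    (hA : ¬ G.Conn Sᶜ c a ∧ ¬ G.Conn Sᶜ c b ∧ ¬ G.Conn Sᶜ a b) :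
    G.WalkAvoiding S (G.cluster Sᶜ a) c b ∨ G.WalkAvoiding S (G.cluster Sᶜ b) c a := by
  have hab : a ≠ b := fun h => hA.2.2 (h ▸ Conn.refl G _ a)
  refine ((G.conn_iff_reachable S c a).1 hca).elim_path fun p => ?_
  by_cases hb : b ∈ p.1.support
  · -- cut the path at `b`: an open path from `c` to `b` missing `a`
    refine Or.inl (walkAvoiding_of_walk (p.1.takeUntil b hb)
      (path_avoids_cluster hdeg hA (Or.inr ⟨rfl, rfl⟩) _ (p.2.takeUntil hb) ?_))
    intro ha
    have hsplit := p.1.take_spec hb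
    have hnodup : p.1.support.Nodup := (Walk.isPath_def _).1 p.2
    rw [← hsplit, Walk.support_append] at hnodup
    have hdisj := List.disjoint_of_nodup_append hnodup
    have ha' : a ∈ (p.1.dropUntil b hb).support.tail := by
      have hmem := Walk.end_mem_support (p.1.dropUntil b hb)
      rw [← Walk.cons_tail_support, List.mem_cons] at hmem
      rcases hmem with h | h
      · exact absurd h hab
      · exact h
    exact hdisj ha ha'
  · exact Or.inr (walkAvoiding_of_walk p.1
      (path_avoids_cluster hdeg hA (Or.inl ⟨rfl, rfl⟩) p.1 p.2 hb))

variable [Fintype E] [DecidableEq E]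

open Classical in
/-- The Bad count vanishes when every bare vertex has at most two edges. -/
theorem card_bad_eq_zero_of_bare_degree_le_two
    (hdeg : ∀ v, v ≠ a → v ≠ b → v ≠ c → ∀ e f g : E, G.EdgeAt e v → G.EdgeAt f v →
      G.EdgeAt g v → e = f ∨ e = g ∨ f = g) :
    (univ.filter fun S : Config E => ((G.Conn S c a ∧ G.Conn S c b) ∧
        (¬ G.Conn Sᶜ c a ∧ ¬ G.Conn Sᶜ c b ∧ ¬ G.Conn Sᶜ a b)) ∧
        ¬ (G.WalkAvoiding S (G.cluster Sᶜ a) c b ∨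
          G.WalkAvoiding S (G.cluster Sᶜ b) c a)).card = 0 := by
  rw [card_eq_zero, filter_eq_empty_iff]
  intro S _ h
  exact h.2 (good_of_bare_degree_le_two hdeg h.1.1.1 h.1.2)

open Classical in
/-- `n(D,A) ≤ |B|` when every bare vertex has at most two edges: every source is Good and the
cluster flips inject the Good sources into the red-`B` configurations. -/
theorem card_DA_le_B_of_bare_degree_le_two [Fintype V] [DecidableEq V]
    (hdeg : ∀ v, v ≠ a → v ≠ b → v ≠ c → ∀ e f g : E, G.EdgeAt e v → G.EdgeAt f v →
      G.EdgeAt g v → e = f ∨ e = g ∨ f = g) :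
    (univ.filter fun S : Config E => (G.Conn S c a ∧ G.Conn S c b) ∧
        (¬ G.Conn Sᶜ c a ∧ ¬ G.Conn Sᶜ c b ∧ ¬ G.Conn Sᶜ a b)).card ≤
      (univ.filter fun T : Config E =>
        (G.Conn T c a ∧ ¬ G.Conn T c b) ∨ (G.Conn T c b ∧ ¬ G.Conn T c a)).card := by
  refine le_trans ?_ (card_good_add_good_le (G := G) a b c)
  refine le_trans (card_le_card ?_) (card_union_le _ _)
  intro S hS
  simp only [mem_filter, mem_univ, true_and, mem_union] at hS ⊢
  rcases good_of_bare_degree_le_two hdeg hS.1.1 hS.2 with h | h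
  · exact Or.inl ⟨hS, h⟩
  · exact Or.inr ⟨hS, h⟩

open Classical in
/-- **THEOREM L2 when every bare vertex has at most two edges**: `(P) ≥ 0` at every band state of the
probe and the two live vertices — in particular on every cycle skeleton. -/
theorem pFun_threeCells_nonneg_of_bare_degree_le_two [Fintype V] [DecidableEq V]
    (hdeg : ∀ v, v ≠ a → v ≠ b → v ≠ c → ∀ e f g : E, G.EdgeAt e v → G.EdgeAt f v →
      G.EdgeAt g v → e = f ∨ e = g ∨ f = g)
    {z κ x₁ K₁ x₂ K₂ : ℝ} (hz : 0 ≤ z ∧ z ≤ 1) (hκ : kMin z ≤ κ) (hx₁ : 0 ≤ x₁ ∧ x₁ ≤ 1)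
    (hx₂ : 0 ≤ x₂ ∧ x₂ ≤ 1) (hK₁ : kMin x₁ ≤ K₁) (hK₂ : kMin x₂ ≤ K₂) :
    0 ≤ G.pFun c (threeCells c a b z x₁ x₂) (threeCells c a b κ K₁ K₂) univ :=
  pFun_threeCells_nonneg_of_bad_le a b c
    (by rw [card_bad_eq_zero_of_bare_degree_le_two hdeg]; exact Nat.zero_le _)
    hz hκ hx₁ hx₂ hK₁ hK₂

end BareDegreeTwo

end MultiGraph

end PercRepro
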